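import Literature.AnabelianGeometry.AbsoluteAnabelian.AbsTopIProp410FiniteLevelProofs
import Literature.AnabelianGeometry.AbsoluteAnabelian.AbsTopIProp410CompatProofs
import Literature.AnabelianGeometry.SemiGraphs.TemperedPolish
import HarnessLib

/-!
# [AbsTopI] Prop 4.10 (iii) at the construction: OPENNESS of the descended maps is a theorem at
# genuine data (open mapping theorem for tempered groups); the assembly over the honest residues
# (proof-only)

S. Mochizuki, *Topics in Absolute Anabelian Geometry I: Generalities* [AbsTopI] (J. Math. Sci.
Univ. Tokyo 19 (2012)), Prop 4.10 (iii) p. 60 / proof p. 61 ("follows immediately from (i)");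
manuscript pagination, lit key `paper:url-11ac98ba15fc`, read on the page; S. Mochizuki, *Semi-graphs
of anabelioids* [SemiAnbd] Def 3.1 (i) p. 33 (tempered groups).  Sub-DAG of record:
`HOME/plan/L4/SUBDAG-AbsTopI-Prop410.md`.

abc-iut-L4-t13 gen 4's assembly `prop410iiiAt_of_rows` (`AbsTopIProp410iiiAssembly.lean`) takes,
besides (i) for `Y`, the two cofinalities and image agreement, the OPENNESS of every descended map
`f̄_H : Π^tp_X ⧸ K_H → Π^tp_Y ⧸ K^Y_H` ("open mapping theorem situation; not derivable from the bare
interface").  Here it is DERIVED at genuine data (`isOpenMap_fbar_of_isTempered`): `f̄_H ∘ (Π^tp_X ↠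
Π^tp_X ⧸ K_H) = (Π^tp_Y ↠ Π^tp_Y ⧸ K^Y_H) ∘ f` is a continuous homomorphism out of the tempered,
first-countable `Π^tp_X`, SURJECTIVE by image agreement (`fbar_surjective`), into `Π^tp_Y ⧸ K^Y_H`,
which is Hausdorff (`K^Y_H` is closed) and BAIRE (`baireSpace_quotient_of_isTempered`: a quotient of a
first-countable tempered group is complete for the right uniformity — abc-iut-L3's
`IsTempered.completeSpace_rightUniformSpace` + Bourbaki GT IX.3.1 Prop. 4, Mathlib
`QuotientGroup.completeSpace_right'` — and pseudo-metrizable); so abc-iut-L3's open mapping theorem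
`IsTempered.isOpenMap_of_surjective` applies, and `f̄_H` is open because the quotient map of
`Π^tp_X` is.  Whence the node AT THE CONSTRUCTION over the HONEST RESIDUES ONLY
(`prop410iiiAt_of_residues`): (i) for `Y` (`SelfCompletionAt Y`, interface-level per the cell's
kit-gate ruling), conjunct 1 of `CoFreeCofinalImAlong` (EXPECTED-TRUE, decider abc-iut-w5-d208),
`Δ_X` topologically finitely generated, the same base field `X.K = Y.K`, abc-iut-L3's parameter
bundles `GroupLevelData` for `X`, `Y` ("`Π^temp` tempered, Galois-countable"), the graph-level
surjectivity (R2) "`H′ = f(f⁻¹H′) · H′^{co-fr}`" and §0 p. 8's standing hypothesis "every Y-index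
admits a minimal co-free subgroup" ([André] Lem. 6.1.1 at genuine data).

Inputs are hypotheses stated in the signatures (no new named facts; FACT-LIST untouched).
HONEST FRAMING: refereed prerequisite papers; nothing here bears on [IUTchIII] Cor 3.12; typed ≠ proved.
-/

noncomputable section

open _root_.Topology Filter
open scoped Uniformity

namespace Literature.AnabelianGeometry.AbsoluteAnabelian.AbsTopI.Prop410

open Literature.AnabelianGeometry.SemiGraphs
open Literature.AnabelianGeometry.AbsoluteAnabelian.AbsTopI

variable {p : ℕ} [Fact p.Prime]

/-! ### Quotients of first-countable tempered groups are Baire -/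

/-- **A quotient of a first-countable tempered group by a normal subgroup is a Baire space**: it is
complete for its right uniform structure (the tempered group is — abc-iut-L3's
`IsTempered.completeSpace_rightUniformSpace` — and quotients of complete first-countable groups are,
Bourbaki GT IX.3.1 Prop. 4 / Mathlib `QuotientGroup.completeSpace_right'`) and that uniformity is
countably generated, so the Baire category theorem applies. [cite: MochizukiSemiAnbd2006, Def 3.1(i) p.33] -/
theorem baireSpace_quotient_of_isTempered {G : Type*} [Group G] [TopologicalSpace G]
    [IsTopologicalGroup G] [FirstCountableTopology G] (hG : IsTempered G) (N : Subgroup G)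
    [N.Normal] : BaireSpace (G ⧸ N) := by
  letI : UniformSpace (G ⧸ N) := IsTopologicalGroup.rightUniformSpace (G ⧸ N)
  haveI : @CompleteSpace G (IsTopologicalGroup.rightUniformSpace G) :=
    hG.completeSpace_rightUniformSpace
  haveI : CompleteSpace (G ⧸ N) := QuotientGroup.completeSpace_right' G N
  haveI : (𝓝 (1 : G ⧸ N)).IsCountablyGenerated := by
    have h : 𝓝 ((1 : G) : G ⧸ N) = Filter.map (QuotientGroup.mk : G → G ⧸ N) (𝓝 (1 : G)) :=
      QuotientGroup.nhds_eq N 1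
    rw [QuotientGroup.mk_one] at h
    rw [h]
    infer_instance
  haveI : (𝓤 (G ⧸ N)).IsCountablyGenerated := by
    rw [uniformity_eq_comap_nhds_one' (G ⧸ N)]
    exact Filter.comap.isCountablyGenerated _ _
  haveI : TopologicalSpace.IsCompletelyPseudoMetrizableSpace (G ⧸ N) :=
    TopologicalSpace.IsCompletelyPseudoMetrizableSpace.of_completeSpace_pseudometrizable
  infer_instance

/-! ### Openness of the descended maps `f̄_H` at genuine data -/

/-- **Openness of `f̄_H : Π^tp_X ⧸ K_H → Π^tp_Y ⧸ K^Y_H` at genuine data**: `Π^tp_X` tempered and first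
countable, `Π^tp_Y` tempered and first countable, and IMAGE AGREEMENT at the X-index `H` ⟹ `f̄_H` is an
open map (open mapping theorem for the surjection `Π^tp_X → Π^tp_Y ⧸ K^Y_H` onto a Hausdorff Baire
group; `f̄_H` is open because `Π^tp_X → Π^tp_X ⧸ K_H` is a quotient map).
[cite: MochizukiAbsTopI2012, Prop 4.10 (iii) p.60] -/
theorem isOpenMap_fbar_of_isTempered {X Y : TemperedCurve p} (E : DeCuspidalization X Y)
    (hXt : IsTempered X.PiTemp) [FirstCountableTopology X.PiTemp]
    (hYt : IsTempered Y.PiTemp) [FirstCountableTopology Y.PiTemp]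
    (H : CharOpenSubgroup X.DeltaTemp)
    (hIA : ∀ q : Y.PiTemp, ∃ g : X.PiTemp,
      ((((ContinuousMonoidHom.id Y.PiHat).comp Y.toHat) q : Y.PiHat) :
          CoFreeQuot (E.fHat.comp X.toHat) H.toSubgroup) =
        toCoFreeQuot (E.fHat.comp X.toHat) H.toSubgroup g) :
    IsOpenMap (fbar (ρX := E.fHat.comp X.toHat)
      (ρY := (ContinuousMonoidHom.id Y.PiHat).comp Y.toHat) (ΔX := X.DeltaTemp) (f := E.f)
      E.compat H) := by
  -- the target `Π^tp_Y ⧸ K^Y_H`: Hausdorff (closed kernel) and Baire (quotient of a tempered group)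
  haveI hclosed : IsClosed ((kerY (E.fHat.comp X.toHat) ((ContinuousMonoidHom.id Y.PiHat).comp Y.toHat)
      X.DeltaTemp H : Subgroup Y.PiTemp) : Set Y.PiTemp) :=
    (isClosed_coFreeKernel (E.fHat.comp X.toHat) H.toSubgroup).preimage
      ((ContinuousMonoidHom.id Y.PiHat).comp Y.toHat).continuous
  haveI : BaireSpace (Y.PiTemp ⧸ kerY (E.fHat.comp X.toHat)
      ((ContinuousMonoidHom.id Y.PiHat).comp Y.toHat) X.DeltaTemp H) :=
    baireSpace_quotient_of_isTempered hYt _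
  haveI : T2Space (Y.PiTemp ⧸ kerY (E.fHat.comp X.toHat)
      ((ContinuousMonoidHom.id Y.PiHat).comp Y.toHat) X.DeltaTemp H) := inferInstance
  -- `g := (Π^tp_Y ↠ Π^tp_Y ⧸ K^Y_H) ∘ f`, continuous and surjective (image agreement)
  let g : X.PiTemp →* Y.PiTemp ⧸ kerY (E.fHat.comp X.toHat)
      ((ContinuousMonoidHom.id Y.PiHat).comp Y.toHat) X.DeltaTemp H :=
    (QuotientGroup.mk' _).comp E.f.toMonoidHom
  have hgc : Continuous g := QuotientGroup.continuous_mk.comp E.f.continuous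
  have hgs : Function.Surjective g := by
    intro z
    obtain ⟨w, rfl⟩ := fbar_surjective E.compat H hIA z
    obtain ⟨x, rfl⟩ := QuotientGroup.mk_surjective w
    exact ⟨x, rfl⟩
  have hgo : IsOpenMap g := hXt.isOpenMap_of_surjective g hgc hgs
  intro O hO
  have himg : (fbar (ρX := E.fHat.comp X.toHat)
      (ρY := (ContinuousMonoidHom.id Y.PiHat).comp Y.toHat) (ΔX := X.DeltaTemp) (f := E.f)
      E.compat H) '' O = g '' ((QuotientGroup.mk : X.PiTemp → _) ⁻¹' O) := by
    ext z
    constructor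
    · rintro ⟨w, hw, rfl⟩
      obtain ⟨x, rfl⟩ := QuotientGroup.mk_surjective w
      exact ⟨x, hw, rfl⟩
    · rintro ⟨x, hx, rfl⟩
      exact ⟨(x : X.PiTemp ⧸ _), hx, rfl⟩
  rw [himg]
  exact hgo _ (hO.preimage QuotientGroup.continuous_mk)

/-- **Openness of all `f̄_H` under abc-iut-L3's `GroupLevelData` bundles** ("`Π^temp` tempered,
Galois-countable") and image agreement. [cite: MochizukiAbsTopI2012, Prop 4.10 (iii) p.60] -/
theorem isOpenMap_fbar_of_groupLevelData {X Y : TemperedCurve p} (E : DeCuspidalization X Y)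
    (dX : X.GroupLevelData) (dY : Y.GroupLevelData)
    (hIA : ∀ (H : CharOpenSubgroup X.DeltaTemp) (q : Y.PiTemp), ∃ g : X.PiTemp,
      ((((ContinuousMonoidHom.id Y.PiHat).comp Y.toHat) q : Y.PiHat) :
          CoFreeQuot (E.fHat.comp X.toHat) H.toSubgroup) =
        toCoFreeQuot (E.fHat.comp X.toHat) H.toSubgroup g)
    (H : CharOpenSubgroup X.DeltaTemp) :
    IsOpenMap (fbar (ρX := E.fHat.comp X.toHat)
      (ρY := (ContinuousMonoidHom.id Y.PiHat).comp Y.toHat) (ΔX := X.DeltaTemp) (f := E.f)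
      E.compat H) := by
  haveI := dX.secondCountableTopology
  haveI := dY.secondCountableTopology
  exact isOpenMap_fbar_of_isTempered E dX.isTempered dY.isTempered H (hIA H)

/-! ### The node at the construction over the honest residues -/

/-- **[AbsTopI] Prop 4.10 (iii) AT THE CONSTRUCTION over the honest residues**: (i) for `Y`,
conjunct 1 of `CoFreeCofinalImAlong` (for every X-index `H` a Y-index `H′` with
`Ŷ-kernel(H′) ≤ X̂-kernel(H)`), `Δ_X` topologically finitely generated, the same base field, L3's
`GroupLevelData` bundles for `X` and `Y`, the graph-level surjectivity (R2)
"`H′ = f(f⁻¹H′) · H′^{co-fr}`", and §0 p. 8's standing hypothesis for the Y-indices ⟹ `Prop410iiiAt E`.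
Conjunct 2, image agreement, density, the finite level (R1) and OPENNESS are all theorems now.
[cite: MochizukiAbsTopI2012, Prop 4.10 (iii) p.60] -/
theorem prop410iiiAt_of_residues {X Y : TemperedCurve p} (E : DeCuspidalization X Y)
    (hY : SelfCompletionAt Y)
    (hleft : ∀ H : CharOpenSubgroup X.DeltaTemp, ∃ H' : CharOpenSubgroup Y.DeltaTemp,
      coFreeKernel ((ContinuousMonoidHom.id Y.PiHat).comp Y.toHat) H'.toSubgroup ≤
        coFreeKernel (E.fHat.comp X.toHat) H.toSubgroup)
    (hfg : IsTopologicallyFinitelyGenerated X.DeltaHat) (hK : X.K = Y.K)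
    (dX : X.GroupLevelData) (dY : Y.GroupLevelData)
    (hR2 : ∀ H' : CharOpenSubgroup Y.DeltaTemp,
      H'.toSubgroup ≤ (H'.toSubgroup.comap E.f.toMonoidHom).map E.f.toMonoidHom ⊔
        cofreeCore H'.toSubgroup)
    (hmin : ∀ H' : CharOpenSubgroup Y.DeltaTemp, ∃ M, IsMinimalCofreeIn H'.toSubgroup M) :
    Prop410iiiAt E := by
  classical
  have hcof : CoFreeCofinalImAlong E :=
    coFreeCofinalImAlong_of_left E (X.isProfiniteCompletion_deltaToHat dX) hfg hleft
  have hdense : DenseRange E.fDelta := denseRange_fDelta_of_graphSurj E hY dX dY hR2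
  choose d hd using hcof.1
  have hIA := imageAgreement_of E (exists_aug_eq_of_K_eq hK) hdense hmin d hd
  exact prop410iiiAt_of_rows E hY hcof hIA (isOpenMap_fbar_of_groupLevelData E dX dY hIA)

end Literature.AnabelianGeometry.AbsoluteAnabelian.AbsTopI.Prop410

end
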